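import Summits.ResolutionOfSingularities.ResolutionOfSingularities.Theorems.ValuativeLuAlphaPTorsorDimTwoDefectless
import Literature.AlgebraicGeometry.Resolution.LocalUniformizationAbhyankarPlaces

/-!
# `Valuative.LuAlphaPTorsor`, line `pfaff-line-log-final-forms`: the residue exit along an
# Abhyankar place of the base field

Route `ResolutionOfSingularities/Valuative`, crux `LuAlphaPTorsor`
(stmt-ResolutionOfSingularities-0641), stub `stub_abhyankarResidueExit` (W1) of the lead's
skeleton of the line `pfaff-line-log-final-forms`, PROVED here (statement verbatim from the
ledger registration).

**Setting.** `k` of characteristic `p`, `O` a valuation ring of the field `K ⊇ k`, `A₀ ⊆ O` a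
finitely generated `k`-subalgebra, `t ∈ K` with `t ^ p ∈ A₀` and `Frac (A₀[t]) = K`;
`K₀ := Frac A₀ = Subfield.closure A₀ ⊆ K`, valued by `O ∩ K₀`.

**Statement.** Assume that `O ∩ K₀` is an Abhyankar place of `K₀/k`
(`IsAbhyankarPlace O (im k) K₀`, ambient form) whose residue field extension over `k` is
separably generated, and that there are `c, g ∈ K₀`, `g ≠ 0`, with `u := (t - c)/g ∈ O` such
that no `z ∈ K₀` has `ν(u - z) < 1` (the residue of the unit `u` is not a residue of `K₀`).
Then some finitely generated `A ⊇ A₀[t]` inside `O` with `Frac A = K` is regular at the centre.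

**Proof.** (1) `ν(u) = 1` (take `z = 0`), so `ν(t - c) = ν(g)`; by
`dimTwo_mem_of_residue_hyp`, `c, g ∈ O` and `b := (t^p - c^p)/g^p` is a unit of `O` with
`t^p - c^p = g^p · b`. (2) Knaf–Kuhlmann 2005, Thm. 1.1 (`KnafKuhlmann2005_Thm11_holds`,
PROVED in the tree in ambient form for arbitrary subfields) applied to the function field
`K₀/k` and the finite set `Z = {generators of A₀} ∪ {c, g, b, b⁻¹} ⊆ O ∩ K₀`, improved by
`exists_normal_smooth_model` to an everywhere smooth model `A₁ ⊆ O ∩ K₀` of `K₀` containing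
`Z`; smooth over a field ⇒ regular at the centre (EGA IV 17.5.8,
`Grothendieck1967_17_5_8.of_field`). This is the proof of `relLU_at_abhyankarPlace`
(`Literature/…/LocalUniformizationAbhyankarPlaces.lean`) with `⊤` replaced by `K₀`
(`abhRes_exists_regular_model_closure`). (3) The landed residue exit `stub_residueExit` on
`A₁` (`A₀ ≤ A₁ ⊆ K₀`, so `Frac A₁ = K₀` and the residue hypothesis transfers).
-/

set_option linter.dupNamespace false

namespace Summit.ResolutionOfSingularities.ResolutionOfSingularities.Theorems.PfaffLine

open IsLocalRing Literature.AlgebraicGeometry.Resolution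

section AbhyankarResidueExitHelpers

variable {k K : Type} [Field k] [Field K] [Algebra k K]

-- adapted from Literature/AlgebraicGeometry/Resolution/LocalUniformizationAbhyankarPlaces.lean
-- (`relLU_at_abhyankarPlace`, with the top subfield replaced by `K₀ = Frac A₀`)
/-- **Relative local uniformization of the base along an Abhyankar place of the subfield
`K₀ = Frac A₀`** (Knaf–Kuhlmann 2005, Thm. 1.1 in affine-model form): if `O ∩ K₀` is an
Abhyankar place of `K₀/k` with separably generated residue field extension, `A₀ ⊆ O` is
finitely generated and `Z ⊆ O ∩ K₀` is finite, then there is a finitely generated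
`k`-subalgebra `A₁` with `A₀ ≤ A₁ ⊆ O ∩ K₀` and `Z ⊆ A₁`, regular at the centre `𝔪_O ∩ A₁`:
the smooth model of Thm. 1.1 with `Z ∪ {generators of A₀}` in its local ring is improved to an
everywhere smooth model containing that set (`exists_normal_smooth_model`), which is regular at
every prime (EGA IV 17.5.8). [cite: KnafKuhlmann2005, Thm. 1.1] -/
theorem abhRes_exists_regular_model_closure (O : ValuationSubring K) (A₀ : Subalgebra k K)
    (h₀ : A₀.toSubring ≤ O.toSubring) (hfg : A₀.FG)
    (hAbh : IsAbhyankarPlace O (algebraMap k K).fieldRange (Subfield.closure (A₀ : Set K)))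
    (hsep : SeparablyGeneratedOver (resField O (algebraMap k K).fieldRange)
      (resField O (Subfield.closure (A₀ : Set K))))
    (Z : Finset K) (hZ : ∀ z ∈ Z, z ∈ O ∧ z ∈ Subfield.closure (A₀ : Set K)) :
    ∃ (A₁ : Subalgebra k K) (h₁ : A₁.toSubring ≤ O.toSubring), A₀ ≤ A₁ ∧ A₁.FG ∧
      (∀ z ∈ Z, z ∈ A₁) ∧ (A₁ : Set K) ⊆ Subfield.closure (A₀ : Set K) ∧
      IsRegularLocalRing (Localization.AtPrime
        (Ideal.comap (Subring.inclusion h₁) (IsLocalRing.maximalIdeal O))) := by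
  classical
  set Kf : Subfield K := (algebraMap k K).fieldRange with hKf
  have hKfO : (Kf : Set K) ⊆ O := by
    rintro _ ⟨c, rfl⟩
    exact h₀ (A₀.algebraMap_mem c)
  have hKfK₀ : Kf ≤ Subfield.closure (A₀ : Set K) := by
    rintro _ ⟨c, rfl⟩
    exact Subfield.subset_closure (A₀.algebraMap_mem c)
  obtain ⟨s, hs⟩ := hfg
  have hsA₀ : (s : Set K) ⊆ A₀ := hs ▸ Algebra.subset_adjoin
  -- `K₀ = k(s)` is finitely generated over `Kf = im k`
  have hfgK₀ : FGOver Kf (Subfield.closure (A₀ : Set K)) := by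
    refine ⟨s, le_antisymm ?_ ?_⟩
    · exact Subfield.closure_le.mpr (Set.union_subset (fun x hx => hKfK₀ hx)
        (hsA₀.trans Subfield.subset_closure))
    · refine Subfield.closure_le.mpr ?_
      let F : Subalgebra k K :=
        { (Subfield.closure ((Kf : Set K) ∪ ↑s)).toSubring with
          algebraMap_mem' := fun c => Subfield.subset_closure (Or.inl ⟨c, rfl⟩) }
      have hA₀F : A₀ ≤ F := by
        rw [← hs]
        exact Algebra.adjoin_le fun x hx => Subfield.subset_closure (Or.inr hx)
      exact fun x hx => hA₀F hx
  -- the finite set `s ∪ Z ⊆ O ∩ K₀` of Thm. 1.1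
  have hZ' : ∀ z ∈ s ∪ Z, z ∈ O ∧ z ∈ Subfield.closure (A₀ : Set K) := by
    intro z hz
    rcases Finset.mem_union.mp hz with hz | hz
    · exact ⟨h₀ (hsA₀ hz), Subfield.subset_closure (hsA₀ hz)⟩
    · exact hZ z hz
  -- Knaf–Kuhlmann 2005, Thm 1.1 on `K₀`
  have hSU : IsSmoothlyUniformizableIn Kf O (Subfield.closure (A₀ : Set K))
      ((s ∪ Z : Finset K) : Set K) :=
    KnafKuhlmann2005_Thm11_holds K O Kf (Subfield.closure (A₀ : Set K)) hKfK₀ hfgK₀ hKfO hAbh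
      hsep (s ∪ Z) hZ'
  -- an everywhere smooth model containing `s ∪ Z`
  obtain ⟨B, hBO, hBK₀, hBfg, hBsm, -, hZB, -⟩ :=
    exists_normal_smooth_model Grothendieck1967_17_5_8_holds Matsumura1987_19_4_holds hSU
  haveI := hBsm
  haveI : Algebra.FiniteType Kf B := (Subalgebra.fg_iff_finiteType B).mp hBfg
  -- the same subring as a `k`-subalgebra
  let A₁ : Subalgebra k K :=
    { B.toSubring.toSubsemiring with
      algebraMap_mem' := fun c => B.algebraMap_mem (⟨algebraMap k K c, c, rfl⟩ : Kf) }
  refine ⟨A₁, hBO, ?_, ?_, ?_, hBK₀, ?_⟩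
  · -- `A₀ ≤ A₁`
    rw [← hs]
    exact Algebra.adjoin_le fun z hz => hZB (Finset.mem_union_left Z hz)
  · -- `A₁` is finitely generated over `k` (by the `Kf`-generators of `B`)
    obtain ⟨t₂, ht₂⟩ := hBfg
    refine ⟨t₂, le_antisymm (Algebra.adjoin_le fun x hx => ?_) fun x hx => ?_⟩
    · change x ∈ B
      rw [← ht₂]
      exact Algebra.subset_adjoin hx
    · let T : Subalgebra Kf K :=
        { (Algebra.adjoin k (t₂ : Set K)).toSubring.toSubsemiring with
          algebraMap_mem' := fun c => by
            obtain ⟨c', hc'⟩ := c.2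
            change (c : K) ∈ Algebra.adjoin k (t₂ : Set K)
            rw [← hc']
            exact (Algebra.adjoin k (t₂ : Set K)).algebraMap_mem c' }
      have hBT : B ≤ T := by
        rw [← ht₂]
        exact Algebra.adjoin_le fun y hy => (Algebra.subset_adjoin hy : y ∈ Algebra.adjoin k _)
      exact hBT hx
  · -- `Z ⊆ A₁`
    exact fun z hz => hZB (Finset.mem_union_right s hz)
  · -- regular at the centre: smooth over the field `Kf` (EGA IV 17.5.8)
    exact Grothendieck1967_17_5_8.of_field Grothendieck1967_17_5_8_holds Kf B
      (centre B O hBO) (isSmoothAt_of_formallySmooth _)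

/-- If `u ∈ O` and no `z ∈ Frac A₀` has `ν(u - z) < 1`, then `ν(u) = 1` (take `z = 0`).
[folklore] -/
theorem abhRes_valuation_eq_one_of_residue_hyp (O : ValuationSubring K) (A₀ : Subalgebra k K)
    {u : K} (hu : u ∈ O)
    (hres : ∀ z : K, z ∈ Subfield.closure (A₀ : Set K) → ¬ O.valuation (u - z) < 1) :
    O.valuation u = 1 := by
  refine le_antisymm ((O.valuation_le_one_iff _).mpr hu) ?_
  have h := hres 0 (zero_mem _)
  rw [sub_zero] at h
  exact not_lt.mp h

end AbhyankarResidueExitHelpers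

/-! ## The stub -/

/-- **Stub `stub_abhyankarResidueExit` (W1) of the line `pfaff-line-log-final-forms`** (crux
`Valuative.LuAlphaPTorsor`, stmt-0641): the residue exit along an Abhyankar place of the base
field. For `k` of characteristic `p`, `O` a valuation ring of `K ⊇ k`, `A₀ ⊆ O` finitely
generated, `t ^ p ∈ A₀`, `Frac (A₀[t]) = K`, `K₀ = Frac A₀`: if `O ∩ K₀` is an Abhyankar place
of `K₀/k` whose residue field extension over `k` is separably generated, and some `c, g ∈ K₀`,
`g ≠ 0`, make `u = (t - c)/g` a unit of `O` whose residue is not a residue of `K₀`, then some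
finitely generated `A ⊇ A₀[t]` inside `O` with `Frac A = K` is regular at the centre. Proof:
`c, g ∈ O`, `b = u ^ p = (t^p - c^p)/g^p` a unit of `O` (`dimTwo_mem_of_residue_hyp`);
Knaf–Kuhlmann 2005, Thm. 1.1 on `K₀` gives a finitely generated `A₁`, `A₀ ≤ A₁ ⊆ O ∩ K₀`,
regular at the centre and containing `c, g, b, b⁻¹` (`abhRes_exists_regular_model_closure`);
conclude by the residue exit `stub_residueExit`. [cite: KnafKuhlmann2005, Thm. 1.1] -/
theorem stub_abhyankarResidueExit :
    ∀ p : ℕ, p.Prime → ∀ (k K : Type) [Field k] [CharP k p] [Field K] [Algebra k K] (O : ValuationSubring K) (A₀ : Subalgebra k K) (h₀ : A₀.toSubring ≤ O.toSubring) (t : K), A₀.FG → ∀ (htp : t ^ p ∈ A₀), IsFractionRing (Algebra.adjoin k (insert t (A₀ : Set K))) K → Literature.AlgebraicGeometry.Resolution.IsAbhyankarPlace O (algebraMap k K).fieldRange (Subfield.closure (A₀ : Set K)) → Literature.AlgebraicGeometry.Resolution.SeparablyGeneratedOver (Literature.AlgebraicGeometry.Resolution.resField O (algebraMap k K).fieldRange)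 (Literature.AlgebraicGeometry.Resolution.resField O (Subfield.closure (A₀ : Set K))) → (∃ c g : K, c ∈ Subfield.closure (A₀ : Set K) ∧ g ∈ Subfield.closure (A₀ : Set K) ∧ g ≠ 0 ∧ (t - c) / g ∈ O ∧ ∀ z : K, z ∈ Subfield.closure (A₀ : Set K) → ¬ O.valuation ((t - c) / g - z) < 1) → ∃ (A : Subalgebra k K) (h : A.toSubring ≤ O.toSubring), A₀ ≤ A ∧ t ∈ A ∧ A.FG ∧ IsFractionRing A K ∧ IsRegularLocalRing (Localization.AtPrime (Ideal.comap (Subring.inclusion h) (IsLocalRing.maximalIdeal O))) := by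
  intro p hp k K _ _ _ _ O A₀ h₀ t hfg htp hfr hAbh hsep hPf
  obtain ⟨c, g, hc, hg, hg0, huO, hres⟩ := hPf
  classical
  haveI : CharP K p := charP_of_injective_algebraMap (algebraMap k K).injective p
  -- `t ∈ O`: valuation rings are integrally closed
  have htO : t ∈ O := mem_valuationSubring_of_pow_mem O hp.ne_zero (h₀ htp)
  -- `ν(u) = 1`, hence `ν(t - c) = ν(g)`
  have hu1 : O.valuation ((t - c) / g) = 1 := abhRes_valuation_eq_one_of_residue_hyp O A₀ huO hres
  have hval : O.valuation (t - c) = O.valuation g := by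
    have htc : t - c = (t - c) / g * g := (div_mul_cancel₀ (t - c) hg0).symm
    rw [htc, map_mul, hu1, one_mul]
  -- `c, g ∈ O`, `b = (t^p - c^p)/g^p` a unit of `O`, `t^p - c^p = g^p · b`
  obtain ⟨hcO, hgO, hbO, hbiO, hbeq⟩ := dimTwo_mem_of_residue_hyp hp O A₀ htO hc hg hg0 hval hres
  set b : K := (t ^ p - c ^ p) / g ^ p with hb
  have htpK₀ : t ^ p ∈ Subfield.closure (A₀ : Set K) := Subfield.subset_closure htp
  have hbK₀ : b ∈ Subfield.closure (A₀ : Set K) :=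
    div_mem (sub_mem htpK₀ (pow_mem hc p)) (pow_mem hg p)
  have hF : ∀ z ∈ ({c, g, b, b⁻¹} : Finset K), z ∈ O ∧ z ∈ Subfield.closure (A₀ : Set K) := by
    intro z hz
    simp only [Finset.mem_insert, Finset.mem_singleton] at hz
    rcases hz with rfl | rfl | rfl | rfl
    · exact ⟨hcO, hc⟩
    · exact ⟨hgO, hg⟩
    · exact ⟨hbO, hbK₀⟩
    · exact ⟨hbiO, inv_mem hbK₀⟩
  -- Knaf–Kuhlmann 2005, Thm. 1.1 on the base field `K₀`: a regular model absorbing `c, g, b, b⁻¹`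
  obtain ⟨A₁, h₁, hle, hA₁fg, hFA₁, hA₁K₀, hA₁reg⟩ :=
    abhRes_exists_regular_model_closure O A₀ h₀ hfg hAbh hsep {c, g, b, b⁻¹} hF
  have hfr₁ : IsFractionRing (Algebra.adjoin k (insert t (A₁ : Set K))) K :=
    isFractionRing_of_le (adjoin_insert_mono' hle t) hfr
  have hcA : c ∈ A₁ := hFA₁ c (by simp)
  have hgA : g ∈ A₁ := hFA₁ g (by simp)
  have hbA : b ∈ A₁ := hFA₁ b (by simp)
  have hbiA : b⁻¹ ∈ A₁ := hFA₁ b⁻¹ (by simp)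
  -- `Frac A₁ = K₀`: the residue hypothesis transfers
  have hres₁ : ∀ z : K, z ∈ Subfield.closure (A₁ : Set K) →
      ¬ O.valuation ((t - c) / g - z) < 1 :=
    fun z hz => hres z (Subfield.closure_le.mpr hA₁K₀ hz)
  -- the residue exit
  obtain ⟨A, h, hle₁, ht, hAfg, hAfr, hAreg⟩ := stub_residueExit p hp k K O A₁ h₁ t hA₁fg
    (hle htp) hfr₁ hA₁reg c g b hcA hgA hbA hbiA hg0 hbeq hres₁
  exact ⟨A, h, hle.trans hle₁, ht, hAfg, hAfr, hAreg⟩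

end Summit.ResolutionOfSingularities.ResolutionOfSingularities.Theorems.PfaffLine
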